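import Summits.SmoothPoincare4.SmoothPoincare4.Theorems.SblfDescentRungOneHelperCollarFlowsAux1
import Literature.Geometry.Manifold.InjOnLocalDiffeomorphInverse
import HarnessLib

/-!
# Rigid collar coordinates, flows II: the fold tube, its inverse parametrisation and the two
# model actions (rotation of the circle parameter, radial flow of the fibre parameter)

Auxiliary file for the sub-bricks `helper_collar_flowV`, `helper_collar_flowW` (layer (F) "flows"
of the registered stub `helper_sliceGluing_rigidCollar`, apex brick F2-collar), line `Sketch`,
crux `SblfDescent.RungOne`.

(Crux item stmt-SmoothPoincare4-18531; skeleton `Cruxes/RungOne/Lines/Sketch.lean`.)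

Let `ν : 𝕊¹ × ℝ³ → X` be `C^∞` and injective on `𝕊¹ × B(0, ε)` with injective differential
there and open image (the `S¹`-parametric tube of the round circle of a simplified broken
Lefschetz fibration in fold normal form, but nothing of that is used here).  We set up:

* `tubeSet ν ε = ν (𝕊¹ × B(0, ε))` and the inverse parametrisation `tubeInv ν ε` (Mathlib's
  `Function.invFunOn`), `C^∞` on the tube by the inverse function theorem (`ν` is an injective
  immersion between `4`-manifolds: the tree's
  `Literature.Geometry.Manifold.contMDiffOn_invFunOn_of_bijective_mfderiv`, Lee 2013, Thm. 4.5);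
* the **model rotation action** `rotAct`, `(t, ν (u, ξ)) ↦ ν (rotS t u, ξ)`, `C^∞` on
  `ℝ × tube`, its generator `rotVel` (a `C^∞` vector field on the tube) and the fact that the
  model curves `t ↦ ν (rotS t u, ξ)` are its integral curves (`hasMFDerivAt_rotCurve`);
* the **model radial action** `radAct`, `(t, ν (u, ξ)) ↦ ν (u, radE t ξ)`, `C^∞` on its open
  domain `radDom` (tube points off the axis `ξ₀ = ξ₁ = 0`, times for which the radial flow is
  defined and stays in the tube), its generator `radVel` and the integral curves
  `t ↦ ν (u, radE t ξ)` (`hasMFDerivAt_radCurve`).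

These are the local models, on the tube, of the two flows of layer (F) (Lee 2013, Prop. 9.7 and
Thm. 9.12: generators of flows).  Everything here is proved; the `def`s are explicit; no named
fact is introduced.

## References

* J. M. Lee, *Introduction to Smooth Manifolds*, 2nd ed. (2013), Thm. 4.5, Prop. 9.7,
  Thm. 9.12. [LeeSmoothManifolds2013]
-/

set_option linter.dupNamespace false

noncomputable section

open scoped Manifold ContDiff Topology RealInnerProductSpace
open Set Function Bundle Literature.Topology.FourManifolds

namespace Summit.SmoothPoincare4.SmoothPoincare4.Cruxes.RungOne.Sketch

/-- Local notation: `𝔼 n` is the model Euclidean space `EuclideanSpace ℝ (Fin n)`. -/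
local notation "𝔼 " n:arg => EuclideanSpace ℝ (Fin n)

attribute [local instance] Literature.Topology.FourManifolds.fact_finrank_euclideanSpace_succ

/-! ### The tube: inverse parametrisation and the two model actions -/

section Tube

variable {X : Type*} {ε : ℝ} {ν : (Metric.sphere (0 : 𝔼 2) 1) × 𝔼 3 → X}

/-- The unit circle is nonempty (needed by `Function.invFunOn`). [folklore] -/
instance instNonemptySphereOne : Nonempty (Metric.sphere (0 : 𝔼 2) 1) :=
  ⟨⟨EuclideanSpace.single 0 1, by simp⟩⟩

/-- The open tube `ν (S¹ × B(0, ε))`. [folklore] -/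
def tubeSet (ν : (Metric.sphere (0 : 𝔼 2) 1) × 𝔼 3 → X) (ε : ℝ) : Set X :=
  ν '' (univ ×ˢ Metric.ball 0 ε)

/-- The inverse parametrisation of the tube (`Function.invFunOn`). [folklore] -/
def tubeInv (ν : (Metric.sphere (0 : 𝔼 2) 1) × 𝔼 3 → X) (ε : ℝ) :
    X → (Metric.sphere (0 : 𝔼 2) 1) × 𝔼 3 :=
  invFunOn ν (univ ×ˢ Metric.ball 0 ε)

/-- A tube point is parametrised by its inverse parameters. [folklore] -/
theorem apply_tubeInv {x : X} (hx : x ∈ tubeSet ν ε) : ν (tubeInv ν ε x) = x :=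
  invFunOn_eq hx

/-- The inverse parameters of a tube point lie in `S¹ × B(0, ε)`. [folklore] -/
theorem tubeInv_mem {x : X} (hx : x ∈ tubeSet ν ε) : tubeInv ν ε x ∈ univ ×ˢ Metric.ball (0 : 𝔼 3) ε :=
  invFunOn_mem hx

/-- The inverse parametrisation inverts `ν` on `S¹ × B(0, ε)`. [folklore] -/
theorem tubeInv_apply (hinj : InjOn ν (univ ×ˢ Metric.ball 0 ε)) {u : Metric.sphere (0 : 𝔼 2) 1}
    {ξ : 𝔼 3} (hξ : ξ ∈ Metric.ball (0 : 𝔼 3) ε) : tubeInv ν ε (ν (u, ξ)) = (u, ξ) :=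
  hinj.leftInvOn_invFunOn ⟨mem_univ _, hξ⟩

/-- Images of `S¹ × B(0, ε)` lie in the tube. [folklore] -/
theorem apply_mem_tubeSet (u : Metric.sphere (0 : 𝔼 2) 1) {ξ : 𝔼 3}
    (hξ : ξ ∈ Metric.ball (0 : 𝔼 3) ε) : ν (u, ξ) ∈ tubeSet ν ε :=
  ⟨(u, ξ), ⟨mem_univ _, hξ⟩, rfl⟩

variable [TopologicalSpace X] [ChartedSpace (𝔼 4) X]

/-- **The differential of the tube map is bijective** where it is injective: source and target
have dimension `4`. [folklore] -/
theorem bijective_mfderiv_tube {p : (Metric.sphere (0 : 𝔼 2) 1) × 𝔼 3}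
    (h : Injective (mfderiv ((𝓡 1).prod 𝓘(ℝ, 𝔼 3)) (𝓡 4) ν p)) :
    Bijective (mfderiv ((𝓡 1).prod 𝓘(ℝ, 𝔼 3)) (𝓡 4) ν p) := by
  refine ⟨h, ?_⟩
  haveI : FiniteDimensional ℝ (TangentSpace ((𝓡 1).prod 𝓘(ℝ, 𝔼 3)) p) :=
    inferInstanceAs (FiniteDimensional ℝ (𝔼 1 × 𝔼 3))
  haveI : FiniteDimensional ℝ (TangentSpace (𝓡 4) (ν p)) :=
    inferInstanceAs (FiniteDimensional ℝ (𝔼 4))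
  have hdim : Module.finrank ℝ (TangentSpace ((𝓡 1).prod 𝓘(ℝ, 𝔼 3)) p) =
      Module.finrank ℝ (TangentSpace (𝓡 4) (ν p)) := by
    change Module.finrank ℝ (𝔼 1 × 𝔼 3) = Module.finrank ℝ (𝔼 4)
    simp [Module.finrank_prod]
  exact (LinearMap.injective_iff_surjective_of_finrank_eq_finrank hdim).1 h

variable [IsManifold (𝓡 4) ∞ X]

/-- **The inverse parametrisation of the tube is smooth** on the tube (inverse function
theorem: `ν` is an injective immersion between `4`-manifolds on the open set `S¹ × B(0, ε)`,
the tree's `contMDiffOn_invFunOn_of_bijective_mfderiv`, Lee 2013, Thm. 4.5).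
[cite: LeeSmoothManifolds2013, Thm. 4.5] -/
theorem contMDiffOn_tubeInv
    (hν : ContMDiffOn ((𝓡 1).prod 𝓘(ℝ, 𝔼 3)) (𝓡 4) ∞ ν (univ ×ˢ Metric.ball 0 ε))
    (hinj : InjOn ν (univ ×ˢ Metric.ball 0 ε))
    (himm : ∀ p : (Metric.sphere (0 : 𝔼 2) 1) × 𝔼 3, p.2 ∈ Metric.ball (0 : 𝔼 3) ε →
      Injective (mfderiv ((𝓡 1).prod 𝓘(ℝ, 𝔼 3)) (𝓡 4) ν p)) :
    ContMDiffOn (𝓡 4) ((𝓡 1).prod 𝓘(ℝ, 𝔼 3)) ∞ (tubeInv ν ε) (tubeSet ν ε) :=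
  Literature.Geometry.Manifold.contMDiffOn_invFunOn_of_bijective_mfderiv
    (isOpen_univ.prod Metric.isOpen_ball) hν hinj
    fun p hp => bijective_mfderiv_tube (himm p hp.2)

omit [IsManifold (𝓡 4) ∞ X] in
/-- A map into the tube built from smooth parameters is smooth: `x ↦ ν (g x)` is `C^∞` on `s`
when `g` is `C^∞` on `s` with values in `S¹ × B(0, ε)`. [folklore] -/
theorem contMDiffOn_tube_comp {EM : Type*} [NormedAddCommGroup EM] [NormedSpace ℝ EM]
    {HM : Type*} [TopologicalSpace HM] {IM : ModelWithCorners ℝ EM HM} {M : Type*}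
    [TopologicalSpace M] [ChartedSpace HM M]
    (hν : ContMDiffOn ((𝓡 1).prod 𝓘(ℝ, 𝔼 3)) (𝓡 4) ∞ ν (univ ×ˢ Metric.ball 0 ε))
    {g : M → (Metric.sphere (0 : 𝔼 2) 1) × 𝔼 3} {s : Set M}
    (hg : ContMDiffOn IM ((𝓡 1).prod 𝓘(ℝ, 𝔼 3)) ∞ g s)
    (hgs : ∀ x ∈ s, (g x).2 ∈ Metric.ball (0 : 𝔼 3) ε) :
    ContMDiffOn IM (𝓡 4) ∞ (fun x => ν (g x)) s :=
  hν.comp hg fun x hx => ⟨mem_univ _, hgs x hx⟩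

/-! #### The rotation action `ν (u, ξ) ↦ ν (rot_t u, ξ)` -/

/-- **The model rotation action** of `ℝ` on the tube, `(t, ν (u, ξ)) ↦ ν (rotS t u, ξ)`
(values off the tube are irrelevant). [folklore] -/
def rotAct (ν : (Metric.sphere (0 : 𝔼 2) 1) × 𝔼 3 → X) (ε : ℝ) (q : ℝ × X) : X :=
  ν (rotS q.1 (tubeInv ν ε q.2).1, (tubeInv ν ε q.2).2)

omit [TopologicalSpace X] [ChartedSpace (𝔼 4) X] [IsManifold (𝓡 4) ∞ X] in
/-- The rotation action on tube points. [folklore] -/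
theorem rotAct_apply (hinj : InjOn ν (univ ×ˢ Metric.ball 0 ε)) (t : ℝ)
    (u : Metric.sphere (0 : 𝔼 2) 1) {ξ : 𝔼 3} (hξ : ξ ∈ Metric.ball (0 : 𝔼 3) ε) :
    rotAct ν ε (t, ν (u, ξ)) = ν (rotS t u, ξ) := by
  simp only [rotAct, tubeInv_apply hinj hξ]

/-- **The rotation action is smooth** on `ℝ × tube`. [folklore] -/
theorem contMDiffOn_rotAct
    (hν : ContMDiffOn ((𝓡 1).prod 𝓘(ℝ, 𝔼 3)) (𝓡 4) ∞ ν (univ ×ˢ Metric.ball 0 ε))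
    (hinj : InjOn ν (univ ×ˢ Metric.ball 0 ε))
    (himm : ∀ p : (Metric.sphere (0 : 𝔼 2) 1) × 𝔼 3, p.2 ∈ Metric.ball (0 : 𝔼 3) ε →
      Injective (mfderiv ((𝓡 1).prod 𝓘(ℝ, 𝔼 3)) (𝓡 4) ν p)) :
    ContMDiffOn (𝓘(ℝ, ℝ).prod (𝓡 4)) (𝓡 4) ∞ (rotAct ν ε) (univ ×ˢ tubeSet ν ε) := by
  have hI : ContMDiffOn (𝓘(ℝ, ℝ).prod (𝓡 4)) ((𝓡 1).prod 𝓘(ℝ, 𝔼 3)) ∞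
      (fun q : ℝ × X => tubeInv ν ε q.2) (univ ×ˢ tubeSet ν ε) :=
    (contMDiffOn_tubeInv hν hinj himm).comp contMDiff_snd.contMDiffOn fun q hq => hq.2
  have hg : ContMDiffOn (𝓘(ℝ, ℝ).prod (𝓡 4)) ((𝓡 1).prod 𝓘(ℝ, 𝔼 3)) ∞
      (fun q : ℝ × X => (rotS q.1 (tubeInv ν ε q.2).1, (tubeInv ν ε q.2).2))
      (univ ×ˢ tubeSet ν ε) := by
    have hR : ContMDiffOn (𝓘(ℝ, ℝ).prod (𝓡 4)) (𝓡 1) ∞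
        (fun q : ℝ × X => rotS q.1 (tubeInv ν ε q.2).1) (univ ×ˢ tubeSet ν ε) :=
      (contMDiff_rotS.comp_contMDiffOn
        (contMDiff_fst.contMDiffOn.prodMk (contMDiff_fst.comp_contMDiffOn hI)) :)
    exact hR.prodMk (contMDiff_snd.comp_contMDiffOn hI)
  exact (contMDiffOn_tube_comp hν hg fun q hq => (tubeInv_mem hq.2).2 :)

/-- **The model rotation field** `Vm = ∂/∂t|₀ rotAct`, a vector field on `X` (meaningful on the
tube). [folklore] -/
def rotVel (ν : (Metric.sphere (0 : 𝔼 2) 1) × 𝔼 3 → X) (ε : ℝ) (x : X) : TangentSpace (𝓡 4) x :=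
  actVel (I := 𝓡 4) (rotAct ν ε) x

/-- **The model rotation field is smooth on the tube.** [folklore] -/
theorem contMDiffOn_rotVel
    (hν : ContMDiffOn ((𝓡 1).prod 𝓘(ℝ, 𝔼 3)) (𝓡 4) ∞ ν (univ ×ˢ Metric.ball 0 ε))
    (hinj : InjOn ν (univ ×ˢ Metric.ball 0 ε)) (hopen : IsOpen (tubeSet ν ε))
    (himm : ∀ p : (Metric.sphere (0 : 𝔼 2) 1) × 𝔼 3, p.2 ∈ Metric.ball (0 : 𝔼 3) ε →
      Injective (mfderiv ((𝓡 1).prod 𝓘(ℝ, 𝔼 3)) (𝓡 4) ν p)) :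
    ContMDiffOn (𝓡 4) (𝓡 4).tangent ∞
      (fun x : X => (⟨x, rotVel ν ε x⟩ : TangentBundle (𝓡 4) X)) (tubeSet ν ε) := by
  refine contMDiffOn_actVel (isOpen_univ.prod hopen) (contMDiffOn_rotAct hν hinj himm)
    (fun x hx => ⟨mem_univ _, hx⟩) fun x hx => ?_
  obtain ⟨⟨u, ξ⟩, ⟨-, hξ⟩, rfl⟩ := hx
  rw [rotAct_apply hinj 0 u hξ, rotS_zero]

/-- **The model rotation curves are integral curves of the model rotation field**:
`t ↦ ν (rotS t u, ξ)` has derivative `Vm` at every time. [folklore] -/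
theorem hasMFDerivAt_rotCurve
    (hν : ContMDiffOn ((𝓡 1).prod 𝓘(ℝ, 𝔼 3)) (𝓡 4) ∞ ν (univ ×ˢ Metric.ball 0 ε))
    (hinj : InjOn ν (univ ×ˢ Metric.ball 0 ε)) (hopen : IsOpen (tubeSet ν ε))
    (himm : ∀ p : (Metric.sphere (0 : 𝔼 2) 1) × 𝔼 3, p.2 ∈ Metric.ball (0 : 𝔼 3) ε →
      Injective (mfderiv ((𝓡 1).prod 𝓘(ℝ, 𝔼 3)) (𝓡 4) ν p))
    (u : Metric.sphere (0 : 𝔼 2) 1) {ξ : 𝔼 3} (hξ : ξ ∈ Metric.ball (0 : 𝔼 3) ε) (s : ℝ) :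
    HasMFDerivAt 𝓘(ℝ, ℝ) (𝓡 4) (fun t : ℝ => ν (rotS t u, ξ)) s
      ((1 : ℝ →L[ℝ] ℝ).smulRight (rotVel ν ε (ν (rotS s u, ξ)))) := by
  have hcurve : (fun t : ℝ => ν (rotS t u, ξ)) = fun t => rotAct ν ε (t, ν (u, ξ)) :=
    funext fun t => (rotAct_apply hinj t u hξ).symm
  have hs : rotAct ν ε (s, ν (u, ξ)) = ν (rotS s u, ξ) := rotAct_apply hinj s u hξ
  rw [hcurve, ← hs]
  refine hasMFDerivAt_act_of_law (isOpen_univ.prod hopen) (contMDiffOn_rotAct hν hinj himm)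
    ⟨mem_univ _, ?_⟩ (Filter.Eventually.of_forall fun τ => ?_)
  · rw [hs]; exact apply_mem_tubeSet _ hξ
  · rw [hs, rotAct_apply hinj _ _ hξ, rotAct_apply hinj _ _ hξ, ← rotS_add, sub_add_cancel]

/-! #### The radial action `ν (u, ξ) ↦ ν (u, radE t ξ)` -/

/-- **The model radial action** of `ℝ` on the tube (off the axis), `(t, ν (u, ξ)) ↦ ν (u, radE t ξ)`.
[folklore] -/
def radAct (ν : (Metric.sphere (0 : 𝔼 2) 1) × 𝔼 3 → X) (ε : ℝ) (q : ℝ × X) : X :=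
  ν ((tubeInv ν ε q.2).1, radE q.1 (tubeInv ν ε q.2).2)

/-- The domain of the radial action: tube points off the axis and times for which the radial
flow is defined and stays in the tube. [folklore] -/
def radDom (ν : (Metric.sphere (0 : 𝔼 2) 1) × 𝔼 3 → X) (ε : ℝ) : Set (ℝ × X) :=
  {q | q.2 ∈ tubeSet ν ε ∧ 0 < mE (tubeInv ν ε q.2).2 ∧ 0 < mE (tubeInv ν ε q.2).2 + q.1 ∧
    radE q.1 (tubeInv ν ε q.2).2 ∈ Metric.ball (0 : 𝔼 3) ε}

omit [TopologicalSpace X] [ChartedSpace (𝔼 4) X] [IsManifold (𝓡 4) ∞ X] in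
/-- The radial action on tube points. [folklore] -/
theorem radAct_apply (hinj : InjOn ν (univ ×ˢ Metric.ball 0 ε)) (t : ℝ)
    (u : Metric.sphere (0 : 𝔼 2) 1) {ξ : 𝔼 3} (hξ : ξ ∈ Metric.ball (0 : 𝔼 3) ε) :
    radAct ν ε (t, ν (u, ξ)) = ν (u, radE t ξ) := by
  simp only [radAct, tubeInv_apply hinj hξ]

omit [TopologicalSpace X] [ChartedSpace (𝔼 4) X] [IsManifold (𝓡 4) ∞ X] in
/-- Membership in the domain of the radial action, for tube points. [folklore] -/
theorem mem_radDom_iff (hinj : InjOn ν (univ ×ˢ Metric.ball 0 ε)) {t : ℝ}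
    {u : Metric.sphere (0 : 𝔼 2) 1} {ξ : 𝔼 3} (hξ : ξ ∈ Metric.ball (0 : 𝔼 3) ε) :
    (t, ν (u, ξ)) ∈ radDom ν ε ↔ 0 < mE ξ ∧ 0 < mE ξ + t ∧ radE t ξ ∈ Metric.ball (0 : 𝔼 3) ε := by
  simp only [radDom, mem_setOf_eq, tubeInv_apply hinj hξ, apply_mem_tubeSet u hξ, true_and]

/-- The domain of the radial action is open. [folklore] -/
theorem isOpen_radDom
    (hν : ContMDiffOn ((𝓡 1).prod 𝓘(ℝ, 𝔼 3)) (𝓡 4) ∞ ν (univ ×ˢ Metric.ball 0 ε))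
    (hinj : InjOn ν (univ ×ˢ Metric.ball 0 ε)) (hopen : IsOpen (tubeSet ν ε))
    (himm : ∀ p : (Metric.sphere (0 : 𝔼 2) 1) × 𝔼 3, p.2 ∈ Metric.ball (0 : 𝔼 3) ε →
      Injective (mfderiv ((𝓡 1).prod 𝓘(ℝ, 𝔼 3)) (𝓡 4) ν p)) :
    IsOpen (radDom ν ε) := by
  have hc : ContinuousOn (fun q : ℝ × X => (q.1, (tubeInv ν ε q.2).2)) (univ ×ˢ tubeSet ν ε) :=
    continuous_fst.continuousOn.prodMk
      ((continuous_snd.comp_continuousOn (contMDiffOn_tubeInv hν hinj himm).continuousOn).comp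
        continuous_snd.continuousOn fun q hq => hq.2)
  have hO : IsOpen {p : ℝ × 𝔼 3 | 0 < mE p.2 ∧ 0 < mE p.2 + p.1 ∧ radE p.1 p.2 ∈ Metric.ball (0 : 𝔼 3) ε} := by
    have h1 := isOpen_radDomE
    refine isOpen_iff_mem_nhds.2 fun p hp => ?_
    have hp' : p ∈ {q : ℝ × 𝔼 3 | 0 < mE q.2 ∧ 0 < mE q.2 + q.1} := ⟨hp.1, hp.2.1⟩
    have hcont : ContinuousAt (fun q : ℝ × 𝔼 3 => radE q.1 q.2) p :=
      (contDiffOn_radE.continuousOn.continuousWithinAt hp').continuousAt (h1.mem_nhds hp')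
    filter_upwards [h1.mem_nhds hp', hcont.preimage_mem_nhds (Metric.isOpen_ball.mem_nhds hp.2.2)]
      with q hq hq'
    exact ⟨hq.1, hq.2, hq'⟩
  have h := hc.isOpen_inter_preimage (isOpen_univ.prod hopen) hO
  convert h using 1
  ext q
  simp only [radDom, mem_setOf_eq, mem_inter_iff, mem_prod, mem_univ, true_and, mem_preimage]

/-- **The radial action is smooth** on its domain. [folklore] -/
theorem contMDiffOn_radAct
    (hν : ContMDiffOn ((𝓡 1).prod 𝓘(ℝ, 𝔼 3)) (𝓡 4) ∞ ν (univ ×ˢ Metric.ball 0 ε))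
    (hinj : InjOn ν (univ ×ˢ Metric.ball 0 ε))
    (himm : ∀ p : (Metric.sphere (0 : 𝔼 2) 1) × 𝔼 3, p.2 ∈ Metric.ball (0 : 𝔼 3) ε →
      Injective (mfderiv ((𝓡 1).prod 𝓘(ℝ, 𝔼 3)) (𝓡 4) ν p)) :
    ContMDiffOn (𝓘(ℝ, ℝ).prod (𝓡 4)) (𝓡 4) ∞ (radAct ν ε) (radDom ν ε) := by
  have hsub : radDom ν ε ⊆ univ ×ˢ tubeSet ν ε := fun q hq => ⟨mem_univ _, hq.1⟩
  have hI : ContMDiffOn (𝓘(ℝ, ℝ).prod (𝓡 4)) ((𝓡 1).prod 𝓘(ℝ, 𝔼 3)) ∞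
      (fun q : ℝ × X => tubeInv ν ε q.2) (radDom ν ε) :=
    ((contMDiffOn_tubeInv hν hinj himm).comp contMDiff_snd.contMDiffOn fun q hq => hq.2).mono hsub
  have hP : ContMDiffOn (𝓘(ℝ, ℝ).prod (𝓡 4)) 𝓘(ℝ, ℝ × 𝔼 3) ∞
      (fun q : ℝ × X => (q.1, (tubeInv ν ε q.2).2)) (radDom ν ε) :=
    contMDiff_fst.contMDiffOn.prodMk_space (contMDiff_snd.comp_contMDiffOn hI)
  have hR : ContMDiffOn (𝓘(ℝ, ℝ).prod (𝓡 4)) 𝓘(ℝ, 𝔼 3) ∞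
      (fun q : ℝ × X => radE q.1 (tubeInv ν ε q.2).2) (radDom ν ε) :=
    (contDiffOn_radE.contMDiffOn.comp hP fun q hq => ⟨hq.2.1, hq.2.2.1⟩ :)
  have hg : ContMDiffOn (𝓘(ℝ, ℝ).prod (𝓡 4)) ((𝓡 1).prod 𝓘(ℝ, 𝔼 3)) ∞
      (fun q : ℝ × X => ((tubeInv ν ε q.2).1, radE q.1 (tubeInv ν ε q.2).2)) (radDom ν ε) :=
    (contMDiff_fst.comp_contMDiffOn hI).prodMk hR
  exact (contMDiffOn_tube_comp hν hg fun q hq => hq.2.2.2 :)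

/-- **The model radial field** `Wm = ∂/∂t|₀ radAct`, a vector field on `X` (meaningful on the
tube off the axis). [folklore] -/
def radVel (ν : (Metric.sphere (0 : 𝔼 2) 1) × 𝔼 3 → X) (ε : ℝ) (x : X) : TangentSpace (𝓡 4) x :=
  actVel (I := 𝓡 4) (radAct ν ε) x

/-- **The model radial field is smooth** on the tube off the axis. [folklore] -/
theorem contMDiffOn_radVel
    (hν : ContMDiffOn ((𝓡 1).prod 𝓘(ℝ, 𝔼 3)) (𝓡 4) ∞ ν (univ ×ˢ Metric.ball 0 ε))
    (hinj : InjOn ν (univ ×ˢ Metric.ball 0 ε)) (hopen : IsOpen (tubeSet ν ε))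
    (himm : ∀ p : (Metric.sphere (0 : 𝔼 2) 1) × 𝔼 3, p.2 ∈ Metric.ball (0 : 𝔼 3) ε →
      Injective (mfderiv ((𝓡 1).prod 𝓘(ℝ, 𝔼 3)) (𝓡 4) ν p)) :
    ContMDiffOn (𝓡 4) (𝓡 4).tangent ∞
      (fun x : X => (⟨x, radVel ν ε x⟩ : TangentBundle (𝓡 4) X))
      {x | x ∈ tubeSet ν ε ∧ 0 < mE (tubeInv ν ε x).2} := by
  refine contMDiffOn_actVel (isOpen_radDom hν hinj hopen himm) (contMDiffOn_radAct hν hinj himm)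
    (fun x hx => ?_) fun x hx => ?_
  · obtain ⟨⟨⟨u, ξ⟩, ⟨-, hξ⟩, rfl⟩, hm⟩ := hx
    rw [tubeInv_apply hinj hξ] at hm
    exact (mem_radDom_iff hinj hξ).2 ⟨hm, by simpa using hm, by rwa [radE_zero hm]⟩
  · obtain ⟨⟨⟨u, ξ⟩, ⟨-, hξ⟩, rfl⟩, hm⟩ := hx
    rw [tubeInv_apply hinj hξ] at hm
    rw [radAct_apply hinj 0 u hξ, radE_zero hm]

/-- **The model radial curves are integral curves of the model radial field**:
`t ↦ ν (u, radE t ξ)` has derivative `Wm` at every time `s` at which the radial flow is defined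
and the point is still in the tube. [folklore] -/
theorem hasMFDerivAt_radCurve
    (hν : ContMDiffOn ((𝓡 1).prod 𝓘(ℝ, 𝔼 3)) (𝓡 4) ∞ ν (univ ×ˢ Metric.ball 0 ε))
    (hinj : InjOn ν (univ ×ˢ Metric.ball 0 ε)) (hopen : IsOpen (tubeSet ν ε))
    (himm : ∀ p : (Metric.sphere (0 : 𝔼 2) 1) × 𝔼 3, p.2 ∈ Metric.ball (0 : 𝔼 3) ε →
      Injective (mfderiv ((𝓡 1).prod 𝓘(ℝ, 𝔼 3)) (𝓡 4) ν p))
    (u : Metric.sphere (0 : 𝔼 2) 1) {ξ : 𝔼 3} (hξ : ξ ∈ Metric.ball (0 : 𝔼 3) ε) (hm : 0 < mE ξ)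
    {s : ℝ} (hs : 0 < mE ξ + s) (hsξ : radE s ξ ∈ Metric.ball (0 : 𝔼 3) ε) :
    HasMFDerivAt 𝓘(ℝ, ℝ) (𝓡 4) (fun t : ℝ => ν (u, radE t ξ)) s
      ((1 : ℝ →L[ℝ] ℝ).smulRight (radVel ν ε (ν (u, radE s ξ)))) := by
  have hcurve : (fun t : ℝ => ν (u, radE t ξ)) = fun t => radAct ν ε (t, ν (u, ξ)) :=
    funext fun t => (radAct_apply hinj t u hξ).symm
  have hsa : radAct ν ε (s, ν (u, ξ)) = ν (u, radE s ξ) := radAct_apply hinj s u hξ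
  rw [hcurve, ← hsa]
  have hm' : mE (radE s ξ) = mE ξ + s := mE_radE hm hs.le
  refine hasMFDerivAt_act_of_law (isOpen_radDom hν hinj hopen himm)
    (contMDiffOn_radAct hν hinj himm) ?_ ?_
  · rw [hsa, mem_radDom_iff hinj hsξ, hm', add_zero, radE_zero (hm'.symm ▸ hs)]
    exact ⟨hs, hs, hsξ⟩
  · -- the local group law, valid as long as `m ξ + τ > 0`
    have hev : ∀ᶠ τ in 𝓝 s, 0 < mE ξ + τ :=
      (continuous_const.add continuous_id).continuousAt.eventually
        (isOpen_Ioi.mem_nhds (by simpa using hs))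
    filter_upwards [hev] with τ hτ
    rw [hsa, radAct_apply hinj _ _ hξ, radAct_apply hinj _ _ hsξ, ← radE_add hm hs]
    · rw [sub_add_cancel]

end Tube

end Summit.SmoothPoincare4.SmoothPoincare4.Cruxes.RungOne.Sketch

end
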